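import Literature.AlgebraicGeometry.Motives.HodgeThetaSubalgebraUnitaryWeightRelations
import HarnessLib

/-!
# The projections `π_X = λ⁻¹ X† X`, `π'_X = λ⁻¹ X X†` of a scaled partial isometry and their commutation rules

Family `hodge`, layer `Literature/AlgebraicGeometry/Motives` (pure linear algebra over `ℂ`; no geometry). Research
context: cell `pub-hodge-ring2` (HONEST FRAMING: research route conditional on HC_CM; not a corollary; Q11.4-sentence-2
already refuted in dim ≥ 3), Literature lane gen 87 — first half of step 5 of the proof plan for the last `p = 37`
cell `(15 | 22)` of Ribet's theorem (steps 2–4: `…SlotIdentity`, `…ScalarOnRange`, `…WeightRelations`; plan in the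
gen-87 README). UNCONDITIONAL; theorems only, no definition, no named fact (D-0026), no `sorry`.

CONTENT (operator algebra): for `X X† X = λ X` (`λ ≠ 0`) the operators `π = λ⁻¹ X† X` and `π' = λ⁻¹ X X†` are
idempotent, `λ⁻¹ (X X† − X† X) = π' − π`, `X π = X = π' X`; for two raising operators `X_i, X_j` (`X_i X_j = X_j X_i = 0`,
`X_i† X_j† = 0`) the weight-one relation `[h_i, X_j] = X_j` reads `π'_i X_j + X_j π_i = X_j`, and `[h_i, h_j] = 0` splits
into `[π_i, π_j] = 0` and `[π'_i, π'_j] = 0`. [cite: GoodmanWallachGTM255, §2.3.1, §4.1.1]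
[cite: HoffmanKunze1971LinearAlgebra, §6.7 (projections), §8.5]

## References
* [GoodmanWallachGTM255] R. Goodman, N. R. Wallach, GTM 255 (2009), §2.3.1, §4.1.1.
* [HoffmanKunze1971LinearAlgebra] K. Hoffman, R. Kunze, *Linear Algebra* (1971), §6.7, §8.5.
-/

noncomputable section

open Module

namespace Literature.AlgebraicGeometry.Motives

namespace HodgeStructure

universe u

variable {W : Type u} [AddCommGroup W] [Module ℂ W]

/-- `π = λ⁻¹ X† X` and `π' = λ⁻¹ X X†` are idempotent, `X π = X = π' X`, and `h_X = π' − π`.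
[cite: HoffmanKunze1971LinearAlgebra, §6.7] [cite: GoodmanWallachGTM255, §2.3.1] -/
theorem UnitaryLeviSetup.proj_idem {X Xa : Module.End ℂ W} {c : ℂ} (hc : c ≠ 0) (hXX : X * Xa * X = c • X) :
    (c⁻¹ • (Xa * X)) * (c⁻¹ • (Xa * X)) = c⁻¹ • (Xa * X) ∧
      (c⁻¹ • (X * Xa)) * (c⁻¹ • (X * Xa)) = c⁻¹ • (X * Xa) ∧
      X * (c⁻¹ • (Xa * X)) = X ∧ (c⁻¹ • (X * Xa)) * X = X ∧
      c⁻¹ • (X * Xa - Xa * X) = c⁻¹ • (X * Xa) - c⁻¹ • (Xa * X) := by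
  refine ⟨?_, ?_, ?_, ?_, smul_sub _ _ _⟩
  · rw [smul_mul_smul_comm, mul_assoc, ← mul_assoc X Xa X, hXX, mul_smul_comm, smul_smul, mul_assoc,
      inv_mul_cancel₀ hc, mul_one]
  · rw [smul_mul_smul_comm, ← mul_assoc, hXX, smul_mul_assoc, smul_smul, mul_assoc c⁻¹, inv_mul_cancel₀ hc, mul_one]
  · rw [mul_smul_comm, ← mul_assoc, hXX, smul_smul, inv_mul_cancel₀ hc, one_smul]
  · rw [smul_mul_assoc, hXX, smul_smul, inv_mul_cancel₀ hc, one_smul]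

/-- The weight-one relation in projection form: `π'_i X_j + X_j π_i = X_j` (`X_i X_j = X_j X_i = 0`).
[cite: GoodmanWallachGTM255, §2.3.1] -/
theorem UnitaryLeviSetup.proj_weight_one {Xi Xai Xj : Module.End ℂ W} {c : ℂ}
    (hij : Xi * Xj = 0) (hji : Xj * Xi = 0)
    (h1 : (c⁻¹ • (Xi * Xai - Xai * Xi)) * Xj - Xj * (c⁻¹ • (Xi * Xai - Xai * Xi)) = Xj) :
    (c⁻¹ • (Xi * Xai)) * Xj + Xj * (c⁻¹ • (Xai * Xi)) = Xj := by
  rw [smul_mul_assoc, mul_smul_comm, ← smul_sub, sub_mul, mul_sub, mul_assoc Xai Xi Xj, hij, mul_zero, sub_zero,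
    ← mul_assoc Xj Xi Xai, hji, zero_mul, zero_sub, sub_neg_eq_add, smul_add] at h1
  rw [smul_mul_assoc, mul_smul_comm]
  exact h1

/-- `[h_i, h_j] = 0` splits: `[π_i, π_j] = 0` and `[π'_i, π'_j] = 0` (the cross terms vanish because `X_j X_i = 0`,
`X_i X_j = 0` and `X_i† X_j† = X_j† X_i† = 0`; the two brackets live on `Q` and on `P`, separated by `Θ`).
[cite: GoodmanWallachGTM255, §2.3.1] [cite: HoffmanKunze1971LinearAlgebra, §6.7] -/
theorem UnitaryLeviSetup.proj_commute {Θ Xi Xai Xj Xaj : Module.End ℂ W} {ci cj : ℂ} (hci : ci ≠ 0) (hcj : cj ≠ 0)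
    (hXiΘ : Xi * Θ = -Xi) (hXjΘ : Xj * Θ = -Xj) (hXaiΘ : Xai * Θ = Xai) (hXajΘ : Xaj * Θ = Xaj)
    (hij : Xi * Xj = 0) (hji : Xj * Xi = 0) (haij : Xai * Xaj = 0) (haji : Xaj * Xai = 0)
    (hcomm : (ci⁻¹ • (Xi * Xai - Xai * Xi)) * (cj⁻¹ • (Xj * Xaj - Xaj * Xj)) =
      (cj⁻¹ • (Xj * Xaj - Xaj * Xj)) * (ci⁻¹ • (Xi * Xai - Xai * Xi))) :
    (Xai * Xi) * (Xaj * Xj) = (Xaj * Xj) * (Xai * Xi) ∧ (Xi * Xai) * (Xj * Xaj) = (Xj * Xaj) * (Xi * Xai) := by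
  have h1 : (Xi * Xai) * (Xaj * Xj) = 0 := by rw [mul_assoc, ← mul_assoc Xai, haij, zero_mul, mul_zero]
  have h2 : (Xaj * Xj) * (Xi * Xai) = 0 := by rw [mul_assoc, ← mul_assoc Xj, hji, zero_mul, mul_zero]
  have h3 : (Xj * Xaj) * (Xai * Xi) = 0 := by rw [mul_assoc, ← mul_assoc Xaj, haji, zero_mul, mul_zero]
  have h4 : (Xai * Xi) * (Xj * Xaj) = 0 := by rw [mul_assoc, ← mul_assoc Xi, hij, zero_mul, mul_zero]
  have hprod : (Xi * Xai - Xai * Xi) * (Xj * Xaj - Xaj * Xj) = (Xj * Xaj - Xaj * Xj) * (Xi * Xai - Xai * Xi) := by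
    rw [smul_mul_smul_comm, smul_mul_smul_comm, mul_comm cj⁻¹ ci⁻¹] at hcomm
    exact smul_right_injective _ (mul_ne_zero (inv_ne_zero hci) (inv_ne_zero hcj)) hcomm
  rw [sub_mul, mul_sub, mul_sub, h1, h4, sub_zero, zero_sub, sub_neg_eq_add, sub_mul, mul_sub, mul_sub, h3, h2,
    sub_zero, zero_sub, sub_neg_eq_add] at hprod
  -- `hprod : A' + A = B' + B`; separate the `P`- and `Q`-blocks with `Θ`
  have hA'Θ : (Xi * Xai) * (Xj * Xaj) * Θ = (Xi * Xai) * (Xj * Xaj) := by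
    rw [mul_assoc (Xi * Xai), mul_assoc Xj, hXajΘ]
  have hAΘ : (Xai * Xi) * (Xaj * Xj) * Θ = -((Xai * Xi) * (Xaj * Xj)) := by
    rw [mul_assoc (Xai * Xi), mul_assoc Xaj, hXjΘ, mul_neg, mul_neg]
  have hB'Θ : (Xj * Xaj) * (Xi * Xai) * Θ = (Xj * Xaj) * (Xi * Xai) := by
    rw [mul_assoc (Xj * Xaj), mul_assoc Xi, hXaiΘ]
  have hBΘ : (Xaj * Xj) * (Xai * Xi) * Θ = -((Xaj * Xj) * (Xai * Xi)) := by
    rw [mul_assoc (Xaj * Xj), mul_assoc Xai, hXiΘ, mul_neg, mul_neg]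
  have hΘ := congrArg (· * Θ) hprod
  simp only [add_mul, hA'Θ, hAΘ, hB'Θ, hBΘ] at hΘ
  have hP : (Xi * Xai) * (Xj * Xaj) + (Xi * Xai) * (Xj * Xaj) = (Xj * Xaj) * (Xi * Xai) + (Xj * Xaj) * (Xi * Xai) := by
    calc (Xi * Xai) * (Xj * Xaj) + (Xi * Xai) * (Xj * Xaj)
        = ((Xi * Xai) * (Xj * Xaj) + (Xai * Xi) * (Xaj * Xj)) + ((Xi * Xai) * (Xj * Xaj) + -((Xai * Xi) * (Xaj * Xj))) := by
          abel
      _ = ((Xj * Xaj) * (Xi * Xai) + (Xaj * Xj) * (Xai * Xi)) + ((Xj * Xaj) * (Xi * Xai) + -((Xaj * Xj) * (Xai * Xi))) := by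
          rw [hprod, hΘ]
      _ = (Xj * Xaj) * (Xi * Xai) + (Xj * Xaj) * (Xi * Xai) := by abel
  have hP' : (Xi * Xai) * (Xj * Xaj) = (Xj * Xaj) * (Xi * Xai) := by
    rw [← two_smul ℂ, ← two_smul ℂ] at hP
    exact smul_right_injective _ two_ne_zero hP
  refine ⟨?_, hP'⟩
  rw [hP'] at hprod
  exact add_left_cancel hprod

end HodgeStructure

end Literature.AlgebraicGeometry.Motives

end
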